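import Mathlib.Tactic.Ring
import Mathlib.Tactic.NormNum
import Summits.CriticalPhenomena.PercolationContinuityZ3.Theorems.PercNearOneGluingNoHeavyLowerTailSahiCTCForms
import Summits.CriticalPhenomena.PercolationContinuityZ3.Theorems.PercNearOneGluingNoHeavyLowerTailSahiCTCG011Form
import Summits.CriticalPhenomena.PercolationContinuityZ3.Theorems.PercNearOneGluingNoHeavyLowerTailSahiCTCPara1Form
import Summits.CriticalPhenomena.PercolationContinuityZ3.Theorems.PercNearOneGluingNoHeavyLowerTailSahiCTCVertexExpansions
import HarnessLib

/-!
# `NoHeavyLowerTail` (crux stmt-CriticalPhenomena-4575), P3 lane: the c = 1 threshold-certificate polynomial `Ñ₁ = G(1,1,1)` relative to a ground finset,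
# its VERTEX EXPANSION, symmetry, base case and the ALL-LIVE FACTORISATION `Ñ₁ = e₁·Θ₁·t̄⁽¹⁾_X·t̄⁽¹⁾_Z` (g9 §10)

Support file (seat `prim-l12-p3`, gen 19; `--supports stmt-CriticalPhenomena-4575`).  Memo `run/shared/lean/prim/prim-l12/FROM-prim-l12-p3-g19-CERTIFICATE-ROAD-G011.md`.
Nothing is asserted about the crux.

`G111V V K_X K_Z = e₁(Π+D₁)(Π·h_Y − h_X·h_Z) − Θ₁·Π·D₁·e_Y − e₁·D₁·(h_X·t_Z + t_X·h_Z) + e₁·Θ₁·t_X·t_Z` (g9 §1 form (A), c = 1; the tree's `N1gen` is the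
`V = univ` instance of the same dictionary).  Generated object-form coefficients `G111N1..4`, `G111V_expand` (`ring`), `hYV_comm`, `eYV_comm`, `G111V_comm`,
`G111V_empty`, `nf2V` and `G111V_eq_of_allLive` / `coeff_G111V_nonneg_of_allLive`, plus the one new atom expansion needed by its certificates.
-/

namespace Summit.CriticalPhenomena.PercolationContinuityZ3.Theorems.SahiCTCForms

open Finset MvPolynomial SahiCTCGenFun SahiCTCWeightedLYM

variable {α : Type*} [DecidableEq α]

section objects
variable (V : Finset α) (K KX KZ : Finset (Finset α)) (v : α)

/-- Non-faces of `K` of size `≥ 2` inside `V` (`t̄⁽¹⁾_K`). [this work] -/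
noncomputable def nf2V : MvPolynomial α ℤ := gf (V.powerset.filter fun S => 2 ≤ #S ∧ S ∉ K)

/-- **The form `G(1,1,1) = Ñ₁` (the c = 1 threshold-certificate polynomial, g9 §1 form (A) with c = 1) relative to the ground finset `V`**:
`e₁(Π+D₁)(Π·h_Y − h_X·h_Z) − Θ₁·Π·D₁·e_Y − e₁·D₁·(h_X·t_Z + t_X·h_Z) + e₁·Θ₁·t_X·t_Z`. [this work] -/
noncomputable def G111V : MvPolynomial α ℤ :=
  E1V V * (PiV V + D1V V) * (PiV V * hYV V KX KZ - hV V KX * hV V KZ) - Th1V V * PiV V * D1V V * eYV V KX KZ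
    - E1V V * D1V V * (hV V KX * tV V KZ + tV V KX * hV V KZ) + E1V V * Th1V V * tV V KX * tV V KZ

/-- The coefficient of `r_v^1` in the vertex expansion of `G111` (object form, generated). [this work] -/
noncomputable def G111N1 (V : Finset α) (KX KZ : Finset (Finset α)) (v : α) : MvPolynomial α ℤ :=
  E1V (V.erase v) * Th1V (V.erase v) * tV (V.erase v) KX * t0L (V.erase v) KZ v
    + E1V (V.erase v) * Th1V (V.erase v) * t0L (V.erase v) KX v * tV (V.erase v) KZ
    + E1V (V.erase v) * D1V (V.erase v) * PiV (V.erase v) * hYV (V.erase v) KX KZ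
    + E1V (V.erase v) * D1V (V.erase v) * PiV (V.erase v) * hY0L (V.erase v) KX KZ v
    - E1V (V.erase v) * D1V (V.erase v) * hV (V.erase v) KX * h0L (V.erase v) KZ v
    - E1V (V.erase v) * D1V (V.erase v) * hV (V.erase v) KX * t0L (V.erase v) KZ v
    - E1V (V.erase v) * D1V (V.erase v) * h0L (V.erase v) KX v * hV (V.erase v) KZ
    - E1V (V.erase v) * D1V (V.erase v) * h0L (V.erase v) KX v * tV (V.erase v) KZ
    - E1V (V.erase v) * D1V (V.erase v) * tV (V.erase v) KX * h0L (V.erase v) KZ v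
    - E1V (V.erase v) * D1V (V.erase v) * t0L (V.erase v) KX v * hV (V.erase v) KZ
    + E1V (V.erase v) * D0V (V.erase v) * PiV (V.erase v) * hYV (V.erase v) KX KZ
    - E1V (V.erase v) * D0V (V.erase v) * hV (V.erase v) KX * hV (V.erase v) KZ
    - E1V (V.erase v) * D0V (V.erase v) * hV (V.erase v) KX * tV (V.erase v) KZ
    - E1V (V.erase v) * D0V (V.erase v) * tV (V.erase v) KX * hV (V.erase v) KZ
    + (2 : MvPolynomial α ℤ) * E1V (V.erase v) * PiV (V.erase v) * PiV (V.erase v) * hYV (V.erase v) KX KZ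
    + E1V (V.erase v) * PiV (V.erase v) * PiV (V.erase v) * hY0L (V.erase v) KX KZ v
    - E1V (V.erase v) * PiV (V.erase v) * hV (V.erase v) KX * hV (V.erase v) KZ
    - E1V (V.erase v) * PiV (V.erase v) * hV (V.erase v) KX * h0L (V.erase v) KZ v
    - E1V (V.erase v) * PiV (V.erase v) * h0L (V.erase v) KX v * hV (V.erase v) KZ
    + E1V (V.erase v) * tV (V.erase v) KX * tV (V.erase v) KZ
    - Th1V (V.erase v) * D1V (V.erase v) * PiV (V.erase v) * hY0L (V.erase v) KX KZ v
    - Th1V (V.erase v) * D1V (V.erase v) * PiV (V.erase v) * eYV (V.erase v) KX KZ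
    - Th1V (V.erase v) * D0V (V.erase v) * PiV (V.erase v) * eYV (V.erase v) KX KZ
    + Th1V (V.erase v) * tV (V.erase v) KX * tV (V.erase v) KZ
    + D1V (V.erase v) * PiV (V.erase v) * hYV (V.erase v) KX KZ
    - D1V (V.erase v) * PiV (V.erase v) * eYV (V.erase v) KX KZ
    - D1V (V.erase v) * hV (V.erase v) KX * hV (V.erase v) KZ
    - D1V (V.erase v) * hV (V.erase v) KX * tV (V.erase v) KZ
    - D1V (V.erase v) * tV (V.erase v) KX * hV (V.erase v) KZ
    + PiV (V.erase v) * PiV (V.erase v) * hYV (V.erase v) KX KZ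
    - PiV (V.erase v) * hV (V.erase v) KX * hV (V.erase v) KZ

/-- The coefficient of `r_v^2` in the vertex expansion of `G111` (object form, generated). [this work] -/
noncomputable def G111N2 (V : Finset α) (KX KZ : Finset (Finset α)) (v : α) : MvPolynomial α ℤ :=
  E1V (V.erase v) * Th1V (V.erase v) * t0L (V.erase v) KX v * t0L (V.erase v) KZ v
    + E1V (V.erase v) * D1V (V.erase v) * PiV (V.erase v) * hY0L (V.erase v) KX KZ v
    - E1V (V.erase v) * D1V (V.erase v) * h0L (V.erase v) KX v * h0L (V.erase v) KZ v
    - E1V (V.erase v) * D1V (V.erase v) * h0L (V.erase v) KX v * t0L (V.erase v) KZ v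
    - E1V (V.erase v) * D1V (V.erase v) * t0L (V.erase v) KX v * h0L (V.erase v) KZ v
    + E1V (V.erase v) * D0V (V.erase v) * PiV (V.erase v) * hYV (V.erase v) KX KZ
    + E1V (V.erase v) * D0V (V.erase v) * PiV (V.erase v) * hY0L (V.erase v) KX KZ v
    - E1V (V.erase v) * D0V (V.erase v) * hV (V.erase v) KX * h0L (V.erase v) KZ v
    - E1V (V.erase v) * D0V (V.erase v) * hV (V.erase v) KX * t0L (V.erase v) KZ v
    - E1V (V.erase v) * D0V (V.erase v) * h0L (V.erase v) KX v * hV (V.erase v) KZ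
    - E1V (V.erase v) * D0V (V.erase v) * h0L (V.erase v) KX v * tV (V.erase v) KZ
    - E1V (V.erase v) * D0V (V.erase v) * tV (V.erase v) KX * h0L (V.erase v) KZ v
    - E1V (V.erase v) * D0V (V.erase v) * t0L (V.erase v) KX v * hV (V.erase v) KZ
    + E1V (V.erase v) * PiV (V.erase v) * PiV (V.erase v) * hYV (V.erase v) KX KZ
    + (2 : MvPolynomial α ℤ) * E1V (V.erase v) * PiV (V.erase v) * PiV (V.erase v) * hY0L (V.erase v) KX KZ v
    - E1V (V.erase v) * PiV (V.erase v) * hV (V.erase v) KX * h0L (V.erase v) KZ v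
    - E1V (V.erase v) * PiV (V.erase v) * h0L (V.erase v) KX v * hV (V.erase v) KZ
    - E1V (V.erase v) * PiV (V.erase v) * h0L (V.erase v) KX v * h0L (V.erase v) KZ v
    + E1V (V.erase v) * tV (V.erase v) KX * t0L (V.erase v) KZ v
    + E1V (V.erase v) * t0L (V.erase v) KX v * tV (V.erase v) KZ
    - Th1V (V.erase v) * D1V (V.erase v) * PiV (V.erase v) * hY0L (V.erase v) KX KZ v
    - Th1V (V.erase v) * D0V (V.erase v) * PiV (V.erase v) * hY0L (V.erase v) KX KZ v
    - Th1V (V.erase v) * D0V (V.erase v) * PiV (V.erase v) * eYV (V.erase v) KX KZ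
    + Th1V (V.erase v) * tV (V.erase v) KX * t0L (V.erase v) KZ v
    + Th1V (V.erase v) * t0L (V.erase v) KX v * tV (V.erase v) KZ
    + D1V (V.erase v) * PiV (V.erase v) * hYV (V.erase v) KX KZ
    - D1V (V.erase v) * PiV (V.erase v) * eYV (V.erase v) KX KZ
    - D1V (V.erase v) * hV (V.erase v) KX * h0L (V.erase v) KZ v
    - D1V (V.erase v) * hV (V.erase v) KX * t0L (V.erase v) KZ v
    - D1V (V.erase v) * h0L (V.erase v) KX v * hV (V.erase v) KZ
    - D1V (V.erase v) * h0L (V.erase v) KX v * tV (V.erase v) KZ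
    - D1V (V.erase v) * tV (V.erase v) KX * h0L (V.erase v) KZ v
    - D1V (V.erase v) * t0L (V.erase v) KX v * hV (V.erase v) KZ
    + D0V (V.erase v) * PiV (V.erase v) * hYV (V.erase v) KX KZ
    - D0V (V.erase v) * PiV (V.erase v) * eYV (V.erase v) KX KZ
    - D0V (V.erase v) * hV (V.erase v) KX * hV (V.erase v) KZ
    - D0V (V.erase v) * hV (V.erase v) KX * tV (V.erase v) KZ
    - D0V (V.erase v) * tV (V.erase v) KX * hV (V.erase v) KZ
    + (2 : MvPolynomial α ℤ) * PiV (V.erase v) * PiV (V.erase v) * hYV (V.erase v) KX KZ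
    + PiV (V.erase v) * PiV (V.erase v) * hY0L (V.erase v) KX KZ v
    - PiV (V.erase v) * hV (V.erase v) KX * hV (V.erase v) KZ
    - PiV (V.erase v) * hV (V.erase v) KX * h0L (V.erase v) KZ v
    - PiV (V.erase v) * h0L (V.erase v) KX v * hV (V.erase v) KZ
    + tV (V.erase v) KX * tV (V.erase v) KZ

/-- The coefficient of `r_v^3` in the vertex expansion of `G111` (object form, generated). [this work] -/
noncomputable def G111N3 (V : Finset α) (KX KZ : Finset (Finset α)) (v : α) : MvPolynomial α ℤ :=
  E1V (V.erase v) * D0V (V.erase v) * PiV (V.erase v) * hY0L (V.erase v) KX KZ v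
    - E1V (V.erase v) * D0V (V.erase v) * h0L (V.erase v) KX v * h0L (V.erase v) KZ v
    - E1V (V.erase v) * D0V (V.erase v) * h0L (V.erase v) KX v * t0L (V.erase v) KZ v
    - E1V (V.erase v) * D0V (V.erase v) * t0L (V.erase v) KX v * h0L (V.erase v) KZ v
    + E1V (V.erase v) * PiV (V.erase v) * PiV (V.erase v) * hY0L (V.erase v) KX KZ v
    - E1V (V.erase v) * PiV (V.erase v) * h0L (V.erase v) KX v * h0L (V.erase v) KZ v
    + E1V (V.erase v) * t0L (V.erase v) KX v * t0L (V.erase v) KZ v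
    - Th1V (V.erase v) * D0V (V.erase v) * PiV (V.erase v) * hY0L (V.erase v) KX KZ v
    + Th1V (V.erase v) * t0L (V.erase v) KX v * t0L (V.erase v) KZ v
    - D1V (V.erase v) * h0L (V.erase v) KX v * h0L (V.erase v) KZ v
    - D1V (V.erase v) * h0L (V.erase v) KX v * t0L (V.erase v) KZ v
    - D1V (V.erase v) * t0L (V.erase v) KX v * h0L (V.erase v) KZ v
    + D0V (V.erase v) * PiV (V.erase v) * hYV (V.erase v) KX KZ
    - D0V (V.erase v) * PiV (V.erase v) * eYV (V.erase v) KX KZ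
    - D0V (V.erase v) * hV (V.erase v) KX * h0L (V.erase v) KZ v
    - D0V (V.erase v) * hV (V.erase v) KX * t0L (V.erase v) KZ v
    - D0V (V.erase v) * h0L (V.erase v) KX v * hV (V.erase v) KZ
    - D0V (V.erase v) * h0L (V.erase v) KX v * tV (V.erase v) KZ
    - D0V (V.erase v) * tV (V.erase v) KX * h0L (V.erase v) KZ v
    - D0V (V.erase v) * t0L (V.erase v) KX v * hV (V.erase v) KZ
    + PiV (V.erase v) * PiV (V.erase v) * hYV (V.erase v) KX KZ
    + (2 : MvPolynomial α ℤ) * PiV (V.erase v) * PiV (V.erase v) * hY0L (V.erase v) KX KZ v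
    - PiV (V.erase v) * hV (V.erase v) KX * h0L (V.erase v) KZ v
    - PiV (V.erase v) * h0L (V.erase v) KX v * hV (V.erase v) KZ
    - PiV (V.erase v) * h0L (V.erase v) KX v * h0L (V.erase v) KZ v
    + tV (V.erase v) KX * t0L (V.erase v) KZ v
    + t0L (V.erase v) KX v * tV (V.erase v) KZ

/-- The coefficient of `r_v^4` in the vertex expansion of `G111` (object form, generated). [this work] -/
noncomputable def G111N4 (V : Finset α) (KX KZ : Finset (Finset α)) (v : α) : MvPolynomial α ℤ :=
  -(D0V (V.erase v) * h0L (V.erase v) KX v * h0L (V.erase v) KZ v)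
    - D0V (V.erase v) * h0L (V.erase v) KX v * t0L (V.erase v) KZ v
    - D0V (V.erase v) * t0L (V.erase v) KX v * h0L (V.erase v) KZ v
    + PiV (V.erase v) * PiV (V.erase v) * hY0L (V.erase v) KX KZ v
    - PiV (V.erase v) * h0L (V.erase v) KX v * h0L (V.erase v) KZ v
    + t0L (V.erase v) KX v * t0L (V.erase v) KZ v


end objects

section expansion
variable {V : Finset α} {v : α} (K KX KZ : Finset (Finset α))

/-- **Vertex expansion** `G111_V = G111_{V−v} + r_v·N₁ + r_v²·N₂ + r_v³·N₃ + r_v⁴·N₄`. [this work] -/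
theorem G111V_expand (hv : v ∈ V) :
    G111V V KX KZ = G111V (V.erase v) KX KZ + X v * G111N1 V KX KZ v + X v ^ 2 * G111N2 V KX KZ v
      + X v ^ 3 * G111N3 V KX KZ v + X v ^ 4 * G111N4 V KX KZ v := by
  have l1 : ((V.erase v).powerset.filter fun S => 2 ≤ #(insert v S)) = (V.erase v).powerset.filter fun S => 1 ≤ #S :=
    link_filter_congr V v fun S hS => by rw [card_insert_of_notMem hS]; exact ⟨fun h => by omega, fun h => by omega⟩
  have l1' : ((V.erase v).powerset.filter fun S => #(insert v S) = 1) = (V.erase v).powerset.filter fun S => #S = 0 :=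
    link_filter_congr V v fun S hS => by rw [card_insert_of_notMem hS]; exact ⟨fun h => by omega, fun h => by omega⟩
  have l2 : ((V.erase v).powerset.filter fun S => #(insert v S) ≤ 1) = (V.erase v).powerset.filter fun S => #S = 0 :=
    link_filter_congr V v fun S hS => by rw [card_insert_of_notMem hS]; exact ⟨fun h => by omega, fun h => by omega⟩
  have l3 : ∀ K : Finset (Finset α), ((V.erase v).powerset.filter fun S => #(insert v S) ≤ 1 ∧ insert v S ∈ K) =
      (V.erase v).powerset.filter fun S => #S = 0 ∧ insert v S ∈ K := fun K =>
    link_filter_congr V v fun S hS => by rw [card_insert_of_notMem hS]; exact and_congr ⟨fun h => by omega, fun h => by omega⟩ Iff.rfl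
  have l4 : ∀ K : Finset (Finset α), ((V.erase v).powerset.filter fun S => 2 ≤ #(insert v S) ∧ insert v S ∈ K) =
      (V.erase v).powerset.filter fun S => 1 ≤ #S ∧ insert v S ∈ K := fun K =>
    link_filter_congr V v fun S hS => by rw [card_insert_of_notMem hS]; exact and_congr ⟨fun h => by omega, fun h => by omega⟩ Iff.rfl
  have l5 : ((V.erase v).powerset.filter fun S => #(insert v S) ≤ 1 ∧ insert v S ∈ KX ∧ insert v S ∈ KZ) =
      (V.erase v).powerset.filter fun S => #S = 0 ∧ insert v S ∈ KX ∧ insert v S ∈ KZ :=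
    link_filter_congr V v fun S hS => by rw [card_insert_of_notMem hS]; exact and_congr ⟨fun h => by omega, fun h => by omega⟩ Iff.rfl
  have l6 : ((V.erase v).powerset.filter fun S => #(insert v S) = 1 ∧ insert v S ∈ KX ∧ insert v S ∈ KZ) =
      (V.erase v).powerset.filter fun S => #S = 0 ∧ insert v S ∈ KX ∧ insert v S ∈ KZ :=
    link_filter_congr V v fun S hS => by rw [card_insert_of_notMem hS]; exact and_congr ⟨fun h => by omega, fun h => by omega⟩ Iff.rfl
  have l7 : gf ((V.erase v).powerset.filter fun S => #S = 0) = (1 : MvPolynomial α ℤ) := by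
    have : ((V.erase v).powerset.filter fun S => #S = 0) = {∅} := by
      ext S; simp only [mem_filter, mem_powerset, card_eq_zero, mem_singleton]
      exact ⟨fun h => h.2, fun h => ⟨h ▸ empty_subset _, h⟩⟩
    rw [this]; unfold gf; rw [sum_singleton]; unfold ind; rw [sum_empty]; rfl
  unfold G111V G111N1 G111N2 G111N3 G111N4 PiV Th1V D1V D0V E1V hV tV hYV eYV h0L t0L hY0L
  rw [gf_powerset_split hv, gf_powerset_filter_split hv (fun S => #S ≤ 1), gf_powerset_filter_split hv (fun S => 2 ≤ #S),
    gf_powerset_filter_split hv (fun S => #S = 1),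
    gf_powerset_filter_split hv (fun S => #S ≤ 1 ∧ S ∈ KX), gf_powerset_filter_split hv (fun S => #S ≤ 1 ∧ S ∈ KZ),
    gf_powerset_filter_split hv (fun S => 2 ≤ #S ∧ S ∈ KX), gf_powerset_filter_split hv (fun S => 2 ≤ #S ∧ S ∈ KZ),
    gf_powerset_filter_split hv (fun S => #S ≤ 1 ∧ S ∈ KX ∧ S ∈ KZ), gf_powerset_filter_split hv (fun S => #S = 1 ∧ S ∈ KX ∧ S ∈ KZ)]
  simp only [l1, l1', l2, l3, l4, l5, l6, l7]
  ring

/-- `h_Y` is symmetric in the two complexes. [this work] -/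
theorem hYV_comm (V : Finset α) : hYV V KX KZ = hYV V KZ KX := by
  unfold hYV; congr 1; exact filter_congr fun S _ => by tauto
/-- `e_Y` is symmetric in the two complexes. [this work] -/
theorem eYV_comm (V : Finset α) : eYV V KX KZ = eYV V KZ KX := by
  unfold eYV; congr 1; exact filter_congr fun S _ => by tauto

/-- `G(1,1,1)` is symmetric in the two complexes. [this work] -/
theorem G111V_comm (V : Finset α) : G111V V KX KZ = G111V V KZ KX := by
  unfold G111V; rw [hYV_comm KX KZ V, eYV_comm KX KZ V]; ring

/-- Base of the induction: on the empty ground set `G(1,1,1) = 0`. [this work] -/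
theorem G111V_empty : G111V (∅ : Finset α) KX KZ = 0 := by
  unfold G111V E1V D1V
  simp only [powerset_empty, filter_singleton, card_empty]
  norm_num [show gf (∅ : Finset (Finset α)) = 0 from by unfold gf; rw [sum_empty]]

/-- **All-live factorisation** (g9 §10): if every point of `V` is live in both complexes (and `∅` lies in both) then
`G111_V = e₁·Θ₁·t̄⁽¹⁾_X·t̄⁽¹⁾_Z`, manifestly with nonnegative coefficients. [this work] -/
theorem G111V_eq_of_allLive {V : Finset α} (h0X : ∅ ∈ KX) (h0Z : ∅ ∈ KZ) (hall : ∀ i ∈ V, ({i} : Finset α) ∈ KX ∧ ({i} : Finset α) ∈ KZ) :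
    G111V V KX KZ = E1V V * Th1V V * nf2V V KX * nf2V V KZ := by
  have small : ∀ S : Finset α, S ⊆ V → #S ≤ 1 → S ∈ KX ∧ S ∈ KZ := by
    intro S hSV hS
    rcases Nat.le_one_iff_eq_zero_or_eq_one.1 hS with h | h
    · rw [card_eq_zero] at h; subst h; exact ⟨h0X, h0Z⟩
    · obtain ⟨i, rfl⟩ := card_eq_one.1 h; exact hall i (hSV (mem_singleton_self i))
  have eX : hV V KX = Th1V V := by
    unfold hV Th1V; congr 1; exact filter_congr fun S hS => ⟨fun h => h.1, fun h => ⟨h, (small S (mem_powerset.1 hS) h).1⟩⟩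
  have eZ : hV V KZ = Th1V V := by
    unfold hV Th1V; congr 1; exact filter_congr fun S hS => ⟨fun h => h.1, fun h => ⟨h, (small S (mem_powerset.1 hS) h).2⟩⟩
  have eY : hYV V KX KZ = Th1V V := by
    unfold hYV Th1V; congr 1; exact filter_congr fun S hS => ⟨fun h => h.1, fun h => ⟨h, small S (mem_powerset.1 hS) h⟩⟩
  have eE : eYV V KX KZ = E1V V := by
    unfold eYV E1V; congr 1; exact filter_congr fun S hS => ⟨fun h => h.1, fun h => ⟨h, small S (mem_powerset.1 hS) (by omega)⟩⟩
  have eD : ∀ K : Finset (Finset α), D1V V = tV V K + nf2V V K := by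
    intro K; unfold D1V tV nf2V
    rw [← gf_union (disjoint_filter.2 fun S _ h => by tauto)]
    congr 1; ext S; simp only [mem_filter, mem_union]; tauto
  have eP : PiV V = Th1V V + D1V V := by
    unfold PiV Th1V D1V
    rw [← gf_union (disjoint_filter.2 fun S _ h => by omega)]
    congr 1; ext S; simp only [mem_filter, mem_union, mem_powerset]; constructor
    · intro h; by_cases h' : #S ≤ 1
      · exact Or.inl ⟨h, h'⟩
      · exact Or.inr ⟨h, by omega⟩
    · rintro (⟨h, _⟩ | ⟨h, _⟩) <;> exact h
  have tX : tV V KX = D1V V - nf2V V KX := by rw [eD KX]; ring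
  have tZ : tV V KZ = D1V V - nf2V V KZ := by rw [eD KZ]; ring
  unfold G111V
  rw [eX, eZ, eY, eE, tX, tZ, eP]
  ring

/-- Hence on an all-live pair `G(1,1,1)` has nonnegative coefficients. [this work] -/
theorem coeff_G111V_nonneg_of_allLive {V : Finset α} (h0X : ∅ ∈ KX) (h0Z : ∅ ∈ KZ)
    (hall : ∀ i ∈ V, ({i} : Finset α) ∈ KX ∧ ({i} : Finset α) ∈ KZ) : ∀ n, 0 ≤ (G111V V KX KZ).coeff n := by
  rw [G111V_eq_of_allLive KX KZ h0X h0Z hall]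
  unfold E1V Th1V nf2V
  exact coeff_mul_nonneg (coeff_mul_nonneg (coeff_mul_nonneg (coeff_gf_nonneg _) (coeff_gf_nonneg _)) (coeff_gf_nonneg _)) (coeff_gf_nonneg _)

end expansion



section expansions
variable (V' : Finset α) (KX KZ : Finset (Finset α)) (v : α)

/-- Atom expansion of a status family (generated). [this work] -/
theorem gf_statFam_obj_dd_Z_BCD : gf (statFam V' KX KZ v (fun _ b L => 1 ≤ L ∧ b ≤ 1)) =
    atom V' KX KZ v 0 0 1 + atom V' KX KZ v 0 0 2 + atom V' KX KZ v 0 0 3 + atom V' KX KZ v 0 1 1 + atom V' KX KZ v 0 1 2 + atom V' KX KZ v 0 1 3 + atom V' KX KZ v 1 0 1 + atom V' KX KZ v 1 0 2 + atom V' KX KZ v 1 0 3 + atom V' KX KZ v 1 1 1 + atom V' KX KZ v 1 1 2 + atom V' KX KZ v 1 1 3 + atom V' KX KZ v 2 0 1 + atom V' KX KZ v 2 0 2 + atom V' KX KZ v 2 0 3 + atom V' KX KZ v 2 1 1 + atom V' KX KZ v 2 1 2 + atom V' KX KZ v 2 1 3 := by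
  rw [gf_statFam]; simp only [Finset.sum_range_succ, Finset.sum_range_zero]; norm_num [add_assoc]

end expansions

end Summit.CriticalPhenomena.PercolationContinuityZ3.Theorems.SahiCTCForms
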